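import Literature.NumberTheory.DiophantineGeometry.StrongHall
import Literature.Barriers.ABC.HallExponentSharp

/-!
# Crux `PolyHeightOfBoundedPrimes` (stmt-ABC-16006), line `Sketch` (idea `mordell-twist-cm-height`):
tightness of the core stub — registered stub `stub_six_le_of_polyStrongHall`, proved

The line (lead skeleton `Cruxes/PolyHeightOfBoundedPrimes/Lines/Sketch.lean`) transfers the crux
`B′ = A → H` to C⁺ = **polynomial strong Hall**: every primitive solution of `x³ − y² = z ≠ 0`
(Bombieri–Gubler 12.5.2, `IsPrimitiveHallSolution`) satisfies `max(|x|³, |z|) ≤ C · rad(z)^A` for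
absolute `A, C`. This file proves the registered calibration stub

* `stub_six_le_of_polyStrongHall` — every witness `(A, C)` of C⁺ has `A ≥ 6`.

Proof. Danilov's Fermat–Pell family (`Literature.Barriers.ABC.danilovX/Y/T`, Elkies's (X5) with
`125(2t − 1)` for `t`): `x = 5⁵t² − 3000t + 719`, `x³ − y² = z = 27(2t − 1) > 0` (`danilov_diff`) with
`z < 0.97 √x` (`danilov_bound`) and `x ≥ n + 1` (`succ_le_danilovT`, `danilovT_le_X`). Each member is
PRIMITIVE: the Bézout identity `4x − (6250t − 2875)(2t − 1) = 1` makes `x` coprime to `2t − 1`, so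
`gcd(x³, y²)`, which divides `x³ − y² = 27(2t − 1)`, divides `27 < 2⁶`, and no `d ≥ 2` has `d⁶ ∣ 27`
(`isPrimitiveHallSolution_danilov`). Then `rad(z) ≤ z < √x`, so a bound `x³ ≤ max(|x|³, |z|) ≤ C · rad(z)^A`
with `A < 6` gives `x^{3 − A₊/2} ≤ max(C, 1)` (`A₊ = max(A, 0) < 6`) for every member, impossible as
`x → ∞`.

Supports stmt-ABC-16006 (registered stub, name and signature verbatim; curried corollary
`six_le_of_polyStrongHall`).

References: L. V. Danilov, *The Diophantine equation `x³ − y² = k` and Hall's conjecture*, Mat. Zametki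
32 (1982) and letter 36 (1984) [Danilov1982]; N. D. Elkies, *Rational points near curves and small nonzero
`|x³ − y²|` via lattice reduction*, ANTS-IV (2000), §4.1 [Elkies2000]; E. Bombieri, W. Gubler, *Heights in
Diophantine Geometry* (2006), 12.5.1–12.5.3 [BombieriGubler2006].
-/

noncomputable section

-- single-conjunct summit ABC: the duplicate ABC.ABC is mandated (CONVENTIONS §2)
set_option linter.dupNamespace false

namespace Summit.ABC.ABC.Theorems.PolyHeightOfBoundedPrimes.MordellTwist

open UniqueFactorizationMonoid Real Literature.NumberTheory.DiophantineGeometry Literature.Barriers.ABC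

/-! ## Danilov's family consists of primitive solutions -/

/-- The Bézout identity `4·xₙ − (6250 tₙ − 2875)(2tₙ − 1) = 1`: Danilov's `xₙ = 5⁵tₙ² − 3000tₙ + 719` is
coprime to `2tₙ − 1`. [cite: Elkies2000, §4.1] -/
theorem isCoprime_danilovX_two_mul_danilovT_sub_one (n : ℕ) :
    IsCoprime (danilovX n) (2 * danilovT n - 1) :=
  ⟨4, -(6250 * danilovT n - 2875), by unfold danilovX; ring⟩

/-- For every member of Danilov's family, `gcd(xₙ³, yₙ²)` divides `27`: it divides
`xₙ³ − yₙ² = 27(2tₙ − 1)` and is coprime to `2tₙ − 1`. [folklore] -/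
theorem gcd_danilov_dvd (n : ℕ) : Int.gcd (danilovX n ^ 3) (danilovY n ^ 2) ∣ 27 := by
  have hg3 : (Int.gcd (danilovX n ^ 3) (danilovY n ^ 2) : ℤ) ∣ danilovX n ^ 3 := Int.gcd_dvd_left ..
  have hg2 : (Int.gcd (danilovX n ^ 3) (danilovY n ^ 2) : ℤ) ∣ danilovY n ^ 2 := Int.gcd_dvd_right ..
  have hgz : (Int.gcd (danilovX n ^ 3) (danilovY n ^ 2) : ℤ) ∣ 27 * (2 * danilovT n - 1) := by
    rw [← danilov_diff n]; exact dvd_sub hg3 hg2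
  have hcop : IsCoprime (Int.gcd (danilovX n ^ 3) (danilovY n ^ 2) : ℤ) (2 * danilovT n - 1) :=
    ((isCoprime_danilovX_two_mul_danilovT_sub_one n).pow_left (m := 3)).of_isCoprime_of_dvd_left hg3
  exact_mod_cast hcop.dvd_of_dvd_mul_right hgz

/-- **Danilov's family is primitive** (B–G 12.5.2): `(xₙ, yₙ, 27(2tₙ − 1))` solves `x³ − y² = z ≠ 0` with
`gcd(x³, y²) ∣ 27` free from sixth powers (`d⁶ ∣ 27 ⟹ d = 1`, as `2⁶ = 64 > 27`).
[cite: Danilov1982, Theorem and 1984 letter] [cite: Elkies2000, §4.1] -/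
theorem isPrimitiveHallSolution_danilov (n : ℕ) :
    IsPrimitiveHallSolution (danilovX n) (danilovY n) (27 * (2 * danilovT n - 1)) := by
  refine ⟨danilov_diff n, ?_, fun d hd ↦ ?_⟩
  · have := one_le_danilovT n; omega
  · have hd27 : d ^ 6 ∣ 27 := hd.trans (gcd_danilov_dvd n)
    have hle : d ^ 6 ≤ 27 := Nat.le_of_dvd (by norm_num) hd27
    have hd2 : d < 2 := by
      by_contra h
      push Not at h
      have h64 : 2 ^ 6 ≤ d ^ 6 := Nat.pow_le_pow_left h 6
      exact absurd (h64.trans hle) (by norm_num)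
    interval_cases d
    · norm_num at hd27
    · rfl

/-- The family read as the input of polynomial strong Hall: for every `n` there is a primitive solution
`(x, y, z)` with `0 < z < √x` and `x ≥ n + 1` (`z = 27(2tₙ − 1) < 0.97 √xₙ`, Danilov's inequality).
[cite: Danilov1982, Theorem and 1984 letter] [cite: Elkies2000, §4.1] -/
theorem exists_isPrimitiveHallSolution_lt_sqrt (n : ℕ) :
    ∃ x y z : ℤ, IsPrimitiveHallSolution x y z ∧ 0 < z ∧ (n : ℝ) + 1 ≤ x ∧
      (z : ℝ) < Real.sqrt x := by
  have ht := one_le_danilovT n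
  have hz0 : (0 : ℤ) < 27 * (2 * danilovT n - 1) := by omega
  refine ⟨danilovX n, danilovY n, 27 * (2 * danilovT n - 1), isPrimitiveHallSolution_danilov n, hz0,
    ?_, ?_⟩
  · have h1 : (((n : ℤ) + 1 : ℤ) : ℝ) ≤ ((danilovX n : ℤ) : ℝ) := by
      exact_mod_cast (succ_le_danilovT n).trans (danilovT_le_X n)
    push_cast at h1
    exact h1
  · have hb := (danilov_bound n).2
    rw [danilov_diff, abs_of_pos (by exact_mod_cast hz0)] at hb
    have hs : 0 ≤ Real.sqrt (danilovX n) := Real.sqrt_nonneg _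
    linarith

/-! ## The registered stub -/

/-- **Registered stub `stub_six_le_of_polyStrongHall` (tightness of C⁺).** Every witness `(A, C)` of
polynomial strong Hall has `A ≥ 6`: on Danilov's primitive family `rad(z) ≤ z < √x` and `x → ∞`, so
`x³ ≤ max(|x|³, |z|) ≤ C · rad(z)^A ≤ max(C, 1) · x^{A₊/2}` (`A₊ = max(A, 0)`) forces `A₊ ≥ 6`, i.e.
`A ≥ 6` ("the exponent `1/2` cannot be improved upon" — here in the radical form of B–G 12.5.3).
[cite: Danilov1982, Theorem and 1984 letter] [cite: Elkies2000, §4.1] -/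
theorem stub_six_le_of_polyStrongHall :
    ∀ A C : ℝ, (∀ x y z : ℤ, IsPrimitiveHallSolution x y z →
      ((max (|x| ^ 3) |z| : ℤ) : ℝ) ≤ C * ((radical z.natAbs : ℕ) : ℝ) ^ A) → 6 ≤ A := by
  intro A C h
  by_contra hA6
  push Not at hA6
  -- constants: `K = max(C, 1) > 0`, `B = A₊ = max(A, 0) ∈ [0, 6)`, `e = 3 − B/2 > 0`, `M = K^{1/e}`
  set K : ℝ := max C 1 with hKdef
  have hK0 : 0 < K := one_pos.trans_le (le_max_right _ _)
  set B : ℝ := max A 0 with hBdef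
  have hAB : A ≤ B := le_max_left _ _
  have hB0 : 0 ≤ B := le_max_right _ _
  have hB6 : B < 6 := max_lt hA6 (by norm_num)
  set e : ℝ := 3 - B / 2 with hedef
  have he : 0 < e := by rw [hedef]; linarith
  set M : ℝ := K ^ e⁻¹ with hMdef
  have hM0 : 0 ≤ M := Real.rpow_nonneg hK0.le _
  obtain ⟨n, hn⟩ := exists_nat_gt M
  -- the `n`-th member of Danilov's family
  obtain ⟨x, y, z, hsol, hz0, hxn, hzx⟩ := exists_isPrimitiveHallSolution_lt_sqrt n
  have hb := h x y z hsol
  have hX0 : (0 : ℝ) < x := by linarith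
  have hMX : M < x := by linarith
  -- `1 ≤ rad(z) ≤ z < √x`
  have hR1 : (1 : ℝ) ≤ ((radical z.natAbs : ℕ) : ℝ) := by exact_mod_cast Nat.radical_pos _
  have hRz : ((radical z.natAbs : ℕ) : ℝ) ≤ (z : ℝ) := by
    have h1 : radical z.natAbs ≤ z.natAbs :=
      Nat.le_of_dvd (Int.natAbs_pos.mpr hz0.ne') radical_dvd_self
    have h2 : ((z.natAbs : ℕ) : ℝ) = (z : ℝ) := by
      rw [Nat.cast_natAbs, Int.cast_abs, abs_of_pos (by exact_mod_cast hz0)]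
    rw [← h2]
    exact_mod_cast h1
  have hRX : ((radical z.natAbs : ℕ) : ℝ) ≤ Real.sqrt x := hRz.trans hzx.le
  -- `x³ ≤ K · rad(z)^A`
  have hX3 : (x : ℝ) ^ 3 ≤ K * ((radical z.natAbs : ℕ) : ℝ) ^ A := by
    have h1 : ((|x| ^ 3 : ℤ) : ℝ) ≤ ((max (|x| ^ 3) |z| : ℤ) : ℝ) := by exact_mod_cast le_max_left _ _
    have h2 : ((|x| ^ 3 : ℤ) : ℝ) = (x : ℝ) ^ 3 := by push_cast; rw [abs_of_pos hX0]
    have h3 : C * ((radical z.natAbs : ℕ) : ℝ) ^ A ≤ K * ((radical z.natAbs : ℕ) : ℝ) ^ A :=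
      mul_le_mul_of_nonneg_right (le_max_left _ _) (Real.rpow_nonneg (by positivity) _)
    linarith
  -- `rad(z)^A ≤ x^{B/2}` and `x³ = x^e · x^{B/2}`, so `x^e ≤ K`
  have hRA : ((radical z.natAbs : ℕ) : ℝ) ^ A ≤ (x : ℝ) ^ (B / 2) := by
    calc ((radical z.natAbs : ℕ) : ℝ) ^ A ≤ ((radical z.natAbs : ℕ) : ℝ) ^ B :=
          Real.rpow_le_rpow_of_exponent_le hR1 hAB
      _ ≤ (Real.sqrt x) ^ B := Real.rpow_le_rpow (by linarith) hRX hB0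
      _ = (x : ℝ) ^ (B / 2) := by
          rw [Real.sqrt_eq_rpow, ← Real.rpow_mul hX0.le]; congr 1; ring
  have hsplit : (x : ℝ) ^ 3 = (x : ℝ) ^ e * (x : ℝ) ^ (B / 2) := by
    rw [← Real.rpow_add hX0, hedef, show (3 - B / 2 + B / 2 : ℝ) = ((3 : ℕ) : ℝ) by norm_num,
      Real.rpow_natCast]
  have hXe : (x : ℝ) ^ e ≤ K := by
    have hXB : 0 < (x : ℝ) ^ (B / 2) := Real.rpow_pos_of_pos hX0 _
    have h1 : (x : ℝ) ^ e * (x : ℝ) ^ (B / 2) ≤ K * (x : ℝ) ^ (B / 2) := by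
      rw [← hsplit]; exact hX3.trans (mul_le_mul_of_nonneg_left hRA hK0.le)
    exact le_of_mul_le_mul_right h1 hXB
  -- but `x > M = K^{1/e}` gives `x^e > K`
  have hKX : K < (x : ℝ) ^ e := by
    calc K = M ^ e := by rw [hMdef, Real.rpow_inv_rpow hK0.le he.ne']
      _ < (x : ℝ) ^ e := Real.rpow_lt_rpow hM0 hMX he
  linarith

/-- Curried form of `stub_six_le_of_polyStrongHall`: a witness exponent of polynomial strong Hall is at
least `6`. [cite: Danilov1982, Theorem and 1984 letter] -/
theorem six_le_of_polyStrongHall {A C : ℝ}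
    (h : ∀ x y z : ℤ, IsPrimitiveHallSolution x y z →
      ((max (|x| ^ 3) |z| : ℤ) : ℝ) ≤ C * ((radical z.natAbs : ℕ) : ℝ) ^ A) : 6 ≤ A :=
  stub_six_le_of_polyStrongHall A C h

end Summit.ABC.ABC.Theorems.PolyHeightOfBoundedPrimes.MordellTwist

end
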